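import Summits.PneNP.PneNP.Theorems.SoloInformedIOShape
import Literature.Computability.MetaComplexity.InstanceComplexityHardSets
import HarnessLib

/-!
# Solo (informed) — the summit as the instance complexity of satisfiable formulas

`PneNP` is `∃ L ∈ NP, L ∉ P`. This file records, as kernel-checked equivalences, the reading of the
summit through **instance complexity** (Ko–Orponen–Schöning–Watanabe 1986/1994, Orponen 1990;
survey: Buhrman–Torenvliet, *On the structure of complete sets*, 1994, §5): for an efficient
universal machine `U` (hypothesis structure `UniversalMachine`; the tree's fixed instance is `stdU`)
call a program `π` **`SAT`-consistent** if every one-bit answer `[b]` it ever gives is correct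
(`U.run ⟨π, y⟩ t = some [b] → (b ↔ y ∈ SAT)`; any other behaviour is "don't know"), and say that
`x` is **`(a, c)`-hard** if no `SAT`-consistent program of length `≤ c log₂|x| + c` answers on `x`
within `|x|^a + a` steps (`ic^{n^a+a}(x : SAT) > c log₂|x| + c`). Then

* `soloInformed_pneNP_iff_sat_infinite_hard_instances` — **`P ≠ NP` iff for all `a, c` there are
  infinitely many `(a, c)`-hard SATISFIABLE formulas** [OKSW94, Thm. 4.1, for `SAT`, members only];
* `soloInformed_pneNP_iff_sat_hard_instance` — equivalently, iff for all `a, c` some satisfiable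
  formula is `(a, c)`-hard (one hard instance per pair of constants already suffices, by the
  finite-patching lemma); on the `P = NP` side: iff for some `a, c` EVERY satisfiable formula is
  answered by a consistent `c log₂ n + c`-bit program in time `n^a + a`;
* `soloInformed_pneNP_iff_sat_infinite_hard_instances_stdU` — the instance at `stdU`.

Like the other solo margins this is an equivalence, not a weakening; its content is WHERE the
hardness must sit if `P ≠ NP`: not in any single algorithm's failure but in individual satisfiable
formulas that defeat every short sound heuristic.  The margin is tight for relativizing methods:
Fortnow–Kummer [FK96, Cor. 20(c)] give, for every `f` with `f(n)/log n → ∞` monotonically, an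
oracle world with `P ≠ NP` in which every `NP` set has `ic^t(x : A) ≤ f(|x|) + O(1)` for ALL `x` —
so "`c log n`" cannot be raised to any `ω(log n)` by a relativizing argument.
Two-line consequences of
`Literature.Computability.MetaComplexity.not_mem_P_iff_infinite_logIC_hard_of_isNPComplete`,
`mem_P_iff_logIC_of_isNPComplete` (Cook–Levin: `isNPComplete_SAT_holds`) and the solo I/O-shape
lemma `soloInformed_pneNP_iff_exists_not_mem`.
-/

namespace Summit.PneNP.PneNP.Theorems

open Literature.Computability.Complexity Literature.Computability.Cryptography
  Literature.Computability.MetaComplexity _root_.Computability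

/-- **`P ≠ NP` iff `SAT` has infinitely many hard satisfiable instances at every logarithmic
threshold** (for every efficient universal machine `U`): for all `a c`, infinitely many `x ∈ SAT`
on which every `SAT`-consistent program of length `≤ c log₂|x| + c` gives no answer within
`|x|^a + a` steps. [cite: OrponenEtAl1994, Thm. 4.1]
[cite: Orponen1990, (main theorem; Thm. 5.7 of BuhrmanTorenvliet1994, held p9)]
[cite: FortnowKummer1996, Cor. 20(c) (relativized optimality of the log threshold; held p12–13)]
[cite: AroraBarak2009, Thm. 2.10 (Cook–Levin)] -/
theorem soloInformed_pneNP_iff_sat_infinite_hard_instances (U : UniversalMachine) :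
    PneNP ↔ ∀ a c : ℕ, Set.Infinite {x : List Bool | x ∈ SAT ∧ ∀ π : List Bool,
      π.length ≤ c * Nat.log 2 x.length + c →
      (∀ (y : List Bool) (t : ℕ) (b : Bool),
        U.run (boolPair π y) t = some [b] → (b = true ↔ y ∈ SAT)) →
      ∀ b : Bool, U.run (boolPair π x) (x.length ^ a + a) ≠ some [b]} := by
  have hSAT : IsNPComplete SAT := isNPComplete_SAT_holds
  rw [← not_mem_P_iff_infinite_logIC_hard_of_isNPComplete U hSAT,
    soloInformed_pneNP_iff_exists_not_mem]
  constructor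
  · rintro ⟨L, hL, hLP⟩ hSATP
    exact hLP (NP_subset_P_of_isNPComplete_of_mem_P hSAT hSATP hL)
  · intro h
    exact ⟨SAT, hSAT.1, h⟩

/-- **`P ≠ NP` iff for all `a c` some satisfiable formula is `(a, c)`-hard**; equivalently
(`P = NP` side) `¬ PneNP` iff for some `a c` every `x ∈ SAT` is answered within `|x|^a + a` steps
by a `SAT`-consistent program of length `≤ c log₂|x| + c` (Orponen's theorem for `SAT`, with the
hypothesis on satisfiable formulas only). [cite: Orponen1990, (main theorem)]
[cite: BuhrmanTorenvliet1994, Thm. 5.7 (held p9)] [cite: OrponenEtAl1994, Thm. 4.1] -/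
theorem soloInformed_pneNP_iff_sat_hard_instance (U : UniversalMachine) :
    PneNP ↔ ∀ a c : ℕ, ∃ x ∈ SAT, ∀ π : List Bool, π.length ≤ c * Nat.log 2 x.length + c →
      (∀ (y : List Bool) (t : ℕ) (b : Bool),
        U.run (boolPair π y) t = some [b] → (b = true ↔ y ∈ SAT)) →
      ∀ b : Bool, U.run (boolPair π x) (x.length ^ a + a) ≠ some [b] := by
  have hSAT : IsNPComplete SAT := isNPComplete_SAT_holds
  rw [soloInformed_pneNP_iff_sat_infinite_hard_instances U]
  refine ⟨fun h a c => ?_, fun h => ?_⟩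
  · obtain ⟨x, hx, hhard⟩ := (h a c).nonempty
    exact ⟨x, hx, hhard⟩
  · refine (not_mem_P_iff_infinite_logIC_hard_of_isNPComplete U hSAT).1 fun hP => ?_
    obtain ⟨a, c, hic⟩ := (mem_P_iff_logIC_of_isNPComplete U hSAT).1 hP
    obtain ⟨x, hx, hhard⟩ := h a c
    obtain ⟨π, hπ, hcons, b, hb⟩ := hic x hx
    exact hhard π hπ hcons b hb

/-- **The summit at the tree's fixed universal machine `stdU`**: `P ≠ NP` iff for all `a c`
infinitely many satisfiable formulas defeat every `SAT`-consistent `stdU`-program of length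
`≤ c log₂ n + c` at time `n^a + a`. [cite: OrponenEtAl1994, Thm. 4.1] -/
theorem soloInformed_pneNP_iff_sat_infinite_hard_instances_stdU :
    PneNP ↔ ∀ a c : ℕ, Set.Infinite {x : List Bool | x ∈ SAT ∧ ∀ π : List Bool,
      π.length ≤ c * Nat.log 2 x.length + c →
      (∀ (y : List Bool) (t : ℕ) (b : Bool),
        stdU.run (boolPair π y) t = some [b] → (b = true ↔ y ∈ SAT)) →
      ∀ b : Bool, stdU.run (boolPair π x) (x.length ^ a + a) ≠ some [b]} :=
  soloInformed_pneNP_iff_sat_infinite_hard_instances stdU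

end Summit.PneNP.PneNP.Theorems
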